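import Literature.AlgebraicGeometry.HodgeTheory.GysinFormalismCorrespondences
import Literature.AlgebraicGeometry.Motives.CyclesDimensionProofs
import Literature.AlgebraicGeometry.HodgeTheory.ZariskiClosedNowhereDense

/-!
# Pull-back of algebraic classes along a general slice `X × {t} ↪ X × C` (`C` a curve)

Route `PadicSemiregularLift` of `HodgeConjecture`, support item `HodgeBeyondAnchors`
(stmt-HodgeConjecture-14054); helper file for the product trick
`HC(X × ℙ¹) ⇒ HC(X)` (file `…HodgeBeyondAnchorsProductDescent`).

For `X`, `C` smooth projective over `ℂ` with `dim C = 1`, the slice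
`i_t = Motives.sliceAt X t : X ⟶ X ⊗ C` (`x ↦ (x, t)`) at a complex point `t ∈ C(ℂ)` is a closed
immersion, NOT flat, so the tree's `map_mem_algebraicClasses_of_flat` does not apply; in print the
pull-back of cycle classes along `i_t` is Fulton's Gysin pull-back / Chow's moving lemma. This file
PROVES, on the tree's carriers (`algebraicClasses = Nᵖ H²ᵖ`, classes supported in codimension
`≥ p`), the elementary case that suffices for the product trick:

* `exists_finite_forall_sliceAt_map_mem_algebraicClasses` — for every
  `x ∈ algebraicClasses (X ⊗ C) p` there is a FINITE set `F` of points of `C` such that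
  `i_t^* x ∈ algebraicClasses X p` for every `t ∈ C(ℂ)` whose underlying point is not in `F`.

Proof: `x` is a sum of classes killed off Zariski-closed `Z ⊆ X ⊗ C` of codimension `≥ p`; for such
a `Z` let `G ⊆ Z` be the (finitely many) generic points of its irreducible components and `F` their
images in `C`. If `pr_C(η) ≠ t` for all `η ∈ G`, every point `z = i_t(w)` of `Z ∩ (X × {t})` is a
STRICT specialisation of some `η ∈ G`, so `codim z ≥ p + 1` in `X ⊗ C`; since `i_t` has the
retraction `pr_X`, `dim {w}⁻ ≤ dim {z}⁻`, and `dim + codim = n` on `X`, `= n + 1` on `X ⊗ C`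
(the tree's `Motives.height_add_coheight_eq_of_smoothOfRelativeDimension`), whence `codim w ≥ p`;
and `i_t^* x` is killed off `i_t⁻¹ Z` (`complexBetti.restrictCompl_map_eq_zero`).

References: W. Fulton, *Intersection Theory* (1998), §10.1 (families of cycles, the fibre
`[W_t]`), Example 10.1.2, and §8.1 (Gysin pull-back along a regular embedding);
A. Grothendieck, *Hodge's general conjecture is false for trivial reasons*, Topology 8 (1969), §1
(functoriality of the support filtration); R. Hartshorne, *Algebraic Geometry*, II Ex. 3.20 (d).
-/

set_option linter.dupNamespace false

noncomputable section

open CategoryTheory AlgebraicGeometry MonoidalCategory CartesianMonoidalCategory Topology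
open Literature.AlgebraicTopology.SingularHomology
open Literature.AlgebraicGeometry Literature.AlgebraicGeometry.HodgeTheory
  Literature.AlgebraicGeometry.Motives

namespace Summit.HodgeConjecture.HodgeConjecture.Theorems.HodgeBeyondAnchors

variable {n : ℕ} {X C : SchemeOver ℂ}

/-! ## The slice `i_t : X → X ⊗ C` on points -/

/-- `pr_C (i_t w) = t` on underlying points (`i_t ≫ pr_C` is the constant map to `t`).
[cite: Fulton1998, §10.1] -/
theorem snd_base_sliceAt_base (t : ComplexPoints C) (w : X.left) :
    (snd X C).left.base ((Motives.sliceAt X t).left.base w) = t.pt := by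
  haveI : Subsingleton ↥(Over.left (specOver ℂ ℂ)) :=
    inferInstanceAs (Subsingleton (PrimeSpectrum ℂ))
  have h2 : (Motives.sliceAt X t ≫ snd X C).left.base w = (toSpecOver X ≫ t).left.base w := by
    rw [Motives.sliceAt_snd X t]
  simp only [Over.comp_left, Scheme.Hom.comp_base, TopCat.coe_comp, Function.comp_apply] at h2
  rw [h2]
  change t.left.base _ = t.left.base _
  congr 1
  exact Subsingleton.elim _ _

/-- `pr_X (i_t w) = w` on underlying points (`i_t ≫ pr_X = 𝟙`). [cite: Fulton1998, §10.1] -/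
theorem fst_base_sliceAt_base (t : ComplexPoints C) (w : X.left) :
    (fst X C).left.base ((Motives.sliceAt X t).left.base w) = w := by
  have h2 : (Motives.sliceAt X t ≫ fst X C).left.base w = w := by
    rw [Motives.sliceAt_fst X t]; rfl
  simpa only [Over.comp_left, Scheme.Hom.comp_base, TopCat.coe_comp, Function.comp_apply] using h2

/-- The slice `i_t` is strictly monotone for the specialisation orders (it is continuous and has
the continuous retraction `pr_X`). [cite: Hartshorne1977, II Ex. 3.20 (d)] -/
theorem strictMono_sliceAt_base (t : ComplexPoints C) :
    StrictMono (fun w : X.left ↦ (Motives.sliceAt X t).left.base w) := by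
  intro a b hab
  simp only [lt_iff_le_not_ge, Scheme.le_iff_specializes] at hab ⊢
  refine ⟨hab.1.map (Motives.sliceAt X t).left.base.hom.continuous, fun h ↦ hab.2 ?_⟩
  have := h.map (fst X C).left.base.hom.continuous
  rwa [fst_base_sliceAt_base, fst_base_sliceAt_base] at this

/-! ## Generic points of a Zariski-closed subset -/

/-- **Finitely many generic points.** A Zariski-closed subset `Z` of a smooth projective complex
variety (a Noetherian sober space) contains a finite subset `G` — the generic points of its
irreducible components — such that every point of `Z` is a specialisation of a point of `G`.
[cite: Hartshorne1977, II Ex. 3.20 (d)] -/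
theorem exists_finite_generic (hY : IsSmoothProjective n X) {Z : Set X.left} (hZ : IsClosed Z) :
    ∃ G : Set X.left, G.Finite ∧ G ⊆ Z ∧ ∀ z ∈ Z, ∃ η ∈ G, η ⤳ z := by
  haveI := Motives.IsSmoothProjective.isLocallyNoetherian_holds hY
  haveI := Motives.IsSmoothProjective.compactSpace_holds hY
  haveI : IsNoetherian X.left := {}
  haveI : QuasiSober Z := hZ.isClosedEmbedding_subtypeVal.quasiSober
  haveI : Finite (irreducibleComponents Z) :=
    (TopologicalSpace.NoetherianSpace.finite_irreducibleComponents (α := Z)).to_subtype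
  let G : Set X.left :=
    Set.range fun t : irreducibleComponents Z ↦ ((t.2.1.genericPoint : Z) : X.left)
  refine ⟨G, Set.finite_range _, ?_, fun z hz ↦ ?_⟩
  · rintro _ ⟨t, rfl⟩; exact Subtype.prop _
  · have ht : irreducibleComponent (⟨z, hz⟩ : Z) ∈ irreducibleComponents Z :=
      irreducibleComponent_mem_irreducibleComponents _
    refine ⟨_, ⟨⟨_, ht⟩, rfl⟩, ?_⟩
    have hgen : IsGenericPoint ht.1.genericPoint (closure (irreducibleComponent (⟨z, hz⟩ : Z))) :=
      ht.1.isGenericPoint_genericPoint_closure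
    rw [isClosed_irreducibleComponent.closure_eq] at hgen
    exact (hgen.specializes mem_irreducibleComponent).map continuous_subtype_val

/-! ## Codimension of a general slice of a closed subset -/

/-- **A general slice meets a closed subset of codimension `≥ p` in codimension `≥ p`.** For `X`
smooth projective of dimension `n`, `C` a smooth projective curve, `Z ⊆ X ⊗ C` with every point of
codimension `≥ p`, `G ⊆ Z` a set of points of which every point of `Z` is a specialisation, and
`t ∈ C(ℂ)` with `pr_C(η) ≠ t` for all `η ∈ G`: every point of `i_t⁻¹ Z ⊆ X` has codimension `≥ p`
(a point `i_t(w) ∈ Z` strictly specialises some `η ∈ G`, so has codimension `≥ p + 1` in `X ⊗ C`,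
and `dim {w}⁻ ≤ dim {i_t w}⁻`, `dim + codim = n` on `X`, `= n + 1` on `X ⊗ C`).
[cite: Fulton1998, §10.1 and Example 10.1.2] [cite: Hartshorne1977, II Ex. 3.20 (d)] -/
theorem le_coheight_of_mem_preimage_sliceAt (hX : IsSmoothProjective n X) (hC : IsSmoothProjective 1 C)
    {Z G : Set (X ⊗ C).left} {p : ℕ} (hZp : ∀ z ∈ Z, (p : ℕ∞) ≤ Order.coheight z) (hGZ : G ⊆ Z)
    (hGcov : ∀ z ∈ Z, ∃ η ∈ G, η ⤳ z) (t : ComplexPoints C)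
    (ht : ∀ η ∈ G, (snd X C).left.base η ≠ t.pt) :
    ∀ w ∈ (fun w ↦ (Motives.sliceAt X t).left.base w) ⁻¹' Z, (p : ℕ∞) ≤ Order.coheight w := by
  intro w hw
  have hXC : IsSmoothProjective (n + 1) (X ⊗ C) := Motives.IsSmoothProjective.tensor_holds hX hC
  haveI := hX.smoothOfRelativeDimension
  haveI := hXC.smoothOfRelativeDimension
  haveI := irreducibleSpace_of_isSmoothProjective' hX
  haveI := irreducibleSpace_of_isSmoothProjective' hXC
  set z : (X ⊗ C).left := (Motives.sliceAt X t).left.base w with hzdef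
  obtain ⟨η, hηG, hηz⟩ := hGcov z hw
  -- `z ≠ η`: `z` lies over `t`, `η` does not
  have hne : z ≠ η := by
    intro h
    exact ht η hηG (by rw [← h, hzdef, snd_base_sliceAt_base])
  have hlt : z < η := lt_iff_le_not_ge.2 ⟨Scheme.le_iff_specializes.2 hηz,
    fun h ↦ hne ((Scheme.le_iff_specializes.1 h).antisymm hηz).eq⟩
  have hcz : Order.coheight η + 1 ≤ Order.coheight z := Order.coheight_add_one_le hlt
  have hηp : (p : ℕ∞) ≤ Order.coheight η := hZp η (hGZ hηG)
  have hdimX : Order.height w + Order.coheight w = n :=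
    Motives.height_add_coheight_eq_of_smoothOfRelativeDimension X.hom n w
  have hdimY : Order.height z + Order.coheight z = (n + 1 : ℕ) :=
    Motives.height_add_coheight_eq_of_smoothOfRelativeDimension (X ⊗ C).hom (n + 1) z
  have hhz : Order.height w ≤ Order.height z :=
    Order.height_le_height_apply_of_strictMono _ (strictMono_sliceAt_base t) w
  -- arithmetic in `ℕ∞` (all quantities are finite)
  have hfin1 : Order.height w ≠ ⊤ :=
    (lt_of_le_of_lt (le_self_add.trans hdimX.le) (ENat.coe_lt_top n)).ne
  have hfin2 : Order.coheight w ≠ ⊤ :=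
    (lt_of_le_of_lt (le_add_self.trans hdimX.le) (ENat.coe_lt_top n)).ne
  have hfin3 : Order.height z ≠ ⊤ :=
    (lt_of_le_of_lt (le_self_add.trans hdimY.le) (ENat.coe_lt_top _)).ne
  have hfin4 : Order.coheight z ≠ ⊤ :=
    (lt_of_le_of_lt (le_add_self.trans hdimY.le) (ENat.coe_lt_top _)).ne
  have hfin5 : Order.coheight η ≠ ⊤ :=
    (lt_of_le_of_lt (le_trans (le_self_add) hcz) (lt_top_iff_ne_top.2 hfin4)).ne
  obtain ⟨a, ha⟩ := ENat.ne_top_iff_exists.1 hfin1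
  obtain ⟨b, hb⟩ := ENat.ne_top_iff_exists.1 hfin2
  obtain ⟨c, hc⟩ := ENat.ne_top_iff_exists.1 hfin3
  obtain ⟨d, hd⟩ := ENat.ne_top_iff_exists.1 hfin4
  obtain ⟨e, he⟩ := ENat.ne_top_iff_exists.1 hfin5
  rw [← ha, ← hb] at hdimX
  rw [← hc, ← hd] at hdimY
  rw [← ha, ← hc] at hhz
  rw [← he, ← hd] at hcz
  rw [← he] at hηp
  rw [← hb]
  have h1 : a + b = n := by exact_mod_cast hdimX
  have h2 : c + d = n + 1 := by exact_mod_cast hdimY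
  have h3 : a ≤ c := by exact_mod_cast hhz
  have h4 : e + 1 ≤ d := by exact_mod_cast hcz
  have h5 : p ≤ e := by exact_mod_cast hηp
  exact_mod_cast (show p ≤ b by omega)

/-! ## Slices of algebraic classes are generically algebraic -/

/-- **Slices of algebraic classes are generically algebraic.** For `X` smooth projective of
dimension `n`, `C` a smooth projective curve and `x ∈ algebraicClasses (X ⊗ C) p = Nᵖ H²ᵖ`, there is
a finite set `F` of points of `C` such that `i_t^* x ∈ algebraicClasses X p` for every complex point
`t` of `C` not lying over `F` (`x` is a finite sum of classes killed off closed `Z` of codimension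
`≥ p`; take for `F` the images in `C` of the generic points of the components of these `Z`; then
`i_t^* x` is killed off `i_t⁻¹ Z`, of codimension `≥ p` by `le_coheight_of_mem_preimage_sliceAt`).
In print: `i_t^*[W] = [W_t]` for a family of cycles `W` over a curve, Fulton Example 10.1.2 /
Cor. 10.1. [cite: Fulton1998, §10.1, Example 10.1.2] [cite: GrothendieckTopology1969, §1] -/
theorem exists_finite_forall_sliceAt_map_mem_algebraicClasses (hX : IsSmoothProjective n X)
    (hC : IsSmoothProjective 1 C) {p : ℕ} {x : complexBetti (X ⊗ C) (2 * p)}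
    (hx : x ∈ algebraicClasses (X ⊗ C) p) :
    ∃ F : Set C.left, F.Finite ∧ ∀ t : ComplexPoints C, t.pt ∉ F →
      complexBetti.map (Motives.sliceAt X t) (2 * p) x ∈ algebraicClasses X p := by
  have hXC : IsSmoothProjective (n + 1) (X ⊗ C) := Motives.IsSmoothProjective.tensor_holds hX hC
  induction hx using Submodule.iSup_induction' with
  | mem Z x hxZ =>
    by_cases hZ : IsClosed Z
    · rw [iSup_pos hZ] at hxZ
      by_cases hZp : ∀ z ∈ Z, (p : ℕ∞) ≤ Order.coheight z
      · rw [iSup_pos hZp, LinearMap.mem_ker] at hxZ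
        obtain ⟨G, hGfin, hGZ, hGcov⟩ := exists_finite_generic hXC hZ
        refine ⟨(fun η ↦ (snd X C).left.base η) '' G, hGfin.image _, fun t ht ↦ ?_⟩
        have ht' : ∀ η ∈ G, (snd X C).left.base η ≠ t.pt := fun η hη h ↦ ht ⟨η, hη, h⟩
        exact mem_supportedClasses_of_restrictCompl_eq_zero
          (hZ.preimage (Motives.sliceAt X t).left.base.hom.continuous)
          (le_coheight_of_mem_preimage_sliceAt hX hC hZp hGZ hGcov t ht')
          (complexBetti.restrictCompl_map_eq_zero (Motives.sliceAt X t) hxZ)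
      · rw [iSup_neg hZp] at hxZ
        rw [(Submodule.mem_bot ℂ).1 hxZ]
        exact ⟨∅, Set.finite_empty, fun t _ ↦ by rw [map_zero]; exact Submodule.zero_mem _⟩
    · rw [iSup_neg hZ] at hxZ
      rw [(Submodule.mem_bot ℂ).1 hxZ]
      exact ⟨∅, Set.finite_empty, fun t _ ↦ by rw [map_zero]; exact Submodule.zero_mem _⟩
  | zero => exact ⟨∅, Set.finite_empty, fun t _ ↦ by rw [map_zero]; exact Submodule.zero_mem _⟩
  | add x y hx' hy' ihx ihy =>
    obtain ⟨F, hF, hFx⟩ := ihx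
    obtain ⟨F', hF', hFy⟩ := ihy
    refine ⟨F ∪ F', hF.union hF', fun t ht ↦ ?_⟩
    rw [Set.mem_union, not_or] at ht
    rw [map_add]
    exact Submodule.add_mem _ (hFx t ht.1) (hFy t ht.2)

/-- **A general slice of an algebraic class is algebraic**: if the complex points of the curve
`C` do not all lie over a finite set of points (e.g. `C(ℂ)` infinite with `t ↦ t.pt` injective),
every `x ∈ algebraicClasses (X ⊗ C) p` has SOME slice `i_t^* x ∈ algebraicClasses X p`.
[cite: Fulton1998, §10.1, Example 10.1.2] -/
theorem exists_sliceAt_map_mem_algebraicClasses (hX : IsSmoothProjective n X)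
    (hC : IsSmoothProjective 1 C)
    (hinf : ∀ F : Set C.left, F.Finite → ∃ t : ComplexPoints C, t.pt ∉ F)
    {p : ℕ} {x : complexBetti (X ⊗ C) (2 * p)} (hx : x ∈ algebraicClasses (X ⊗ C) p) :
    ∃ t : ComplexPoints C, complexBetti.map (Motives.sliceAt X t) (2 * p) x ∈ algebraicClasses X p := by
  obtain ⟨F, hF, h⟩ := exists_finite_forall_sliceAt_map_mem_algebraicClasses hX hC hx
  obtain ⟨t, ht⟩ := hinf F hF
  exact ⟨t, h t ht⟩

end Summit.HodgeConjecture.HodgeConjecture.Theorems.HodgeBeyondAnchors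

end
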